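import Mathlib
import Literature.RingTheory.CohomologyAnnihilator.ReductionModRegular
import Literature.RingTheory.CohomologyAnnihilator.SyzygyDescent
import Literature.RingTheory.CohomologyAnnihilator.Localization
import Summits.ResolutionOfSingularities.ResolutionOfSingularities.Theorems.HomologicalConductorNoZenoStableAnnihilatorReduction
import Summits.ResolutionOfSingularities.ResolutionOfSingularities.Theorems.HomologicalConductorPersistenceQuotientHypersurfaceSaturation
import HarnessLib

/-!
# Crux `Persistence` (stmt-ResolutionOfSingularities-16484), chain W4.4b — QUOTIENT ASCENT of the cohomology
# annihilator: `a ∈ R⁰ ∩ caᵐ⁺²(R)`, `c̄ ∈ caᵐ⁺¹(R ⧸ (a))` ⇒ `c ∈ caᵐ⁺²(R)`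

Route `ResolutionOfSingularities/HomologicalConductor`, chain W4.4b (cell `res-hironaka`), crux `Persistence`
(stmt-ResolutionOfSingularities-16484), KILL CANDIDATE K-C3 (CHAIN w44b v13.3), item K2-LOWER made UNCONDITIONAL
(res-L1-w44b-stub-2 gen 4). `[OURS · L1 w44b]`: folklore homological algebra (the «lower-bound half» of Knörrer's
periodicity / Esentepe's branched-cover theorem, in the form that needs no maximal Cohen–Macaulay modules, no matrix
factorisations and no completeness); NOT a statement of the manuscript under review (Hironaka 2017), and no statement
of that manuscript is used; AI-written, weaker than expert review.

## The theorem (`mem_cohomologyAnnihilatorOfDegree_of_mk_mem`)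

Let `R` be a commutative noetherian ring, `a ∈ R` a non-zero-divisor with `a ∈ caᵐ⁺²(R)`, and `c ∈ R` whose class
lies in `caᵐ⁺¹(R ⧸ (a))`.  Then `c ∈ caᵐ⁺²(R)`.

PROOF (all ingredients are in the tree).  By CA1 (`mem_cohomologyAnnihilatorOfDegree_succ_iff_forall_isSyzygy`) it
suffices that `c` stably annihilates every `(m+1)`-th syzygy `N` of a finitely generated `R`-module `X`.  Peel
`N = Ωᵐ X₁`, `X₁ = Ω X` (so `a` is `X₁`-regular); by Dao–Takahashi (`IsSyzygy.quotSMulTop`) `N/aN` is an `m`-th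
syzygy of `X₁/aX₁` over `R̄ = R ⧸ (a)` and `a` is `N`-regular; by hypothesis and CA1 over `R̄`, `c̄ • 𝟙_{N/aN}`
factors through a finitely generated projective `R̄`-module `P̄`, which has `pd_R ≤ 1`
(`hasProjectiveDimensionLT_two_of_projective_quotient`), so `c` kills `Ext^{≥2}_R(N/aN, −)`.  Since `a ∈ caᵐ⁺²(R)`
kills `Ext¹_R(N, −) ↪ Extᵐ⁺²_R(X, −)`, Iyengar–Takahashi's Remark 2.12 (`exists_retract_isSyzygy_quotSMulTop`,
= Knörrer's lemma) makes `N` a retract of a first `R`-syzygy `L` of `N/aN`; `c` kills `Ext^{≥1}_R(L, −)` (injective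
dimension shifting), hence `Ext^{≥1}_R(N, −)`, hence stably annihilates `N`.

Corollaries: the ideal form `(caᵐ⁺¹(R ⧸ (a))).comap mk ≤ caᵐ⁺²(R)`, and the `ca`-form
`a ∈ R⁰ ∩ ca(R) ⇒ (ca(R ⧸ (a))).comap mk ≤ ca(R)`; a version with the quotient ideal as a variable (`I = (a)`).

USE (K-C3, fact-free K2-lower): twice, along `k[x,y,z,t]/(xy − h) →(x − y) k[x,z,t]/(x² − h) →(x) k[z,t]/(h)`,
`h = z³ + t⁴`, the `a`'s being Jacobian (`y, x`; `2x`), starting from `𝔠(h) ⊆ ca²` of the curve (sibling files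
`…PersistenceConductorStable`, `…PersistenceKC3LowerCurve`, `…PersistenceKC3Lower`).

References (mechanism only): S. B. Iyengar, R. Takahashi, IMRN 2016 (arXiv:1404.1476) Remark 2.12, §2
[`IyengarTakahashi2014`]; H. Dao, R. Takahashi, ANT 8 (2014) Lemma 5.6 [`DaoTakahashi2014`]; H. Knörrer, Invent.
Math. 88 (1987) (the lemma `Ω(N/aN) ≅ N ⊕ ΩN`); Ö. Esentepe, J. Algebra 541 (2020) Thm 5.4 (whose lower-bound half
this replaces for the chain).
-/

noncomputable section

-- single-problem summit: the doubled namespace component `ResolutionOfSingularities` is forced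
set_option linter.dupNamespace false

namespace Summit.ResolutionOfSingularities.ResolutionOfSingularities.Theorems.HomologicalConductor.QuotientAscent

open CategoryTheory CategoryTheory.Abelian Literature.RingTheory.CohomologyAnnihilator
open Summit.ResolutionOfSingularities.ResolutionOfSingularities.Theorems.NoZeno.SandwichCluster
open Summit.ResolutionOfSingularities.ResolutionOfSingularities.Theorems.HomologicalConductor.QuotientHypersurfaceSaturation
open scoped Pointwise nonZeroDivisors

universe u

variable {R : Type u} [CommRing R]

/-! ## The `R`-module `N/aN` and the restriction of the `R/(a)`-module `N/aN` -/

/-- The identity map is an `R`-linear isomorphism between the restriction of scalars (along `R → R ⧸ (a)`) of the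
`R ⧸ (a)`-module `N ⧸ aN` and `N ⧸ aN` with its quotient `R`-module structure (stated as `Nonempty`, to keep this
file definition-free). [folklore] -/
theorem nonempty_restrictQuotIso (a : R) (N : ModuleCat.{u} R) :
    Nonempty ((restrictScalarsFunctor R (R ⧸ Ideal.span {a})).obj
        (ModuleCat.of (R ⧸ Ideal.span {a}) (N ⧸ (a • ⊤ : Submodule R N))) ≅
      ModuleCat.of R (N ⧸ (a • ⊤ : Submodule R N))) :=
  ⟨LinearEquiv.toModuleIso
    { toFun := fun x => x
      map_add' := fun _ _ => rfl
      map_smul' := fun _ _ => rfl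
      invFun := fun x => x
      left_inv := fun _ => rfl
      right_inv := fun _ => rfl }⟩

/-- Restriction of scalars along `R → R ⧸ (a)` turns `c̄ • f` into `c • f`. [folklore] -/
theorem restrictScalarsFunctor_map_mk_smul (a c : R) {M M' : ModuleCat.{u} (R ⧸ Ideal.span {a})} (f : M ⟶ M') :
    (restrictScalarsFunctor R (R ⧸ Ideal.span {a})).map (Ideal.Quotient.mk (Ideal.span {a}) c • f) =
      c • (restrictScalarsFunctor R (R ⧸ Ideal.span {a})).map f := by
  ext x
  rfl

/-- **`pd_R ≤ 1` transfer.** If the class `c̄` stably annihilates the `R ⧸ (a)`-module `N/aN` (`a` a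
non-zero-divisor of `R`), then `c` kills `Extⁱ_R(N/aN, Y)` for every `i ≥ 2` and every `R`-module `Y`: the homothety
factors (after restriction of scalars) through a finitely generated projective `R ⧸ (a)`-module, which has projective
dimension `≤ 1` over `R`. [folklore; cite: IyengarTakahashi2014, Remark 2.13] -/
theorem smul_ext_quot_eq_zero_of_stablyAnnihilates {a : R} (ha : a ∈ R⁰) {c : R} {N : ModuleCat.{u} R}
    (h : StablyAnnihilates (R ⧸ Ideal.span {a}) (Ideal.Quotient.mk (Ideal.span {a}) c)
      (ModuleCat.of (R ⧸ Ideal.span {a}) (N ⧸ (a • ⊤ : Submodule R N))))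
    (Y : ModuleCat.{u} R) {i : ℕ} (hi : 2 ≤ i)
    (e : Ext.{u} (ModuleCat.of R (N ⧸ (a • ⊤ : Submodule R N))) Y i) : c • e = 0 := by
  obtain ⟨P, hPfin, hPproj, ι, π, hιπ⟩ := h
  haveI := hPfin
  haveI : Module.Projective (R ⧸ Ideal.span {a}) P := moduleProjective_of_projective P hPproj
  haveI := hasProjectiveDimensionLT_two_of_projective_quotient a ha P
  set F := restrictScalarsFunctor R (R ⧸ Ideal.span {a}) with hF
  have hιπ' : F.map ι ≫ F.map π = c • 𝟙 (F.obj (ModuleCat.of (R ⧸ Ideal.span {a})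
      (N ⧸ (a • ⊤ : Submodule R N)))) := by
    rw [← F.map_comp, hιπ, restrictScalarsFunctor_map_mk_smul, F.map_id]
  have key : ∀ e' : Ext.{u} (F.obj (ModuleCat.of (R ⧸ Ideal.span {a}) (N ⧸ (a • ⊤ : Submodule R N)))) Y i,
      c • e' = 0 := fun e' =>
    smul_ext_eq_zero_of_comp_eq_smul_id_of_hasProjectiveDimensionLT (F.map ι) (F.map π) hιπ' hi e'
  obtain ⟨eN⟩ := nonempty_restrictQuotIso a N
  exact ext_smul_eq_zero_of_iso eN (Iso.refl Y) c key e

/-! ## Small bookkeeping lemmas on syzygies -/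

/-- An `(m+1)`-th syzygy embeds in a finitely generated projective, hence a non-zero-divisor of `R` is regular on
it. [folklore] -/
theorem isSMulRegular_of_isSyzygy_succ {a : R} (ha : a ∈ R⁰) {m : ℕ} {X N : ModuleCat.{u} R}
    (hN : IsSyzygy (m + 1) X N) : IsSMulRegular N a := by
  obtain ⟨N', P, -, -, hP, f, g, w, hS⟩ := hN
  exact isSMulRegular_of_injective f.hom hS.moduleCat_injective_f (isSMulRegular_of_projective ha P hP)

/-! ## The ascent theorem -/

/-- **QUOTIENT ASCENT of the cohomology annihilator.**  `R` noetherian, `a ∈ R` a non-zero-divisor with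
`a ∈ caᵐ⁺²(R)`, and `c ∈ R` with `c̄ ∈ caᵐ⁺¹(R ⧸ (a))`.  Then `c ∈ caᵐ⁺²(R)`.
(Knörrer's lemma in the form [IyengarTakahashi2014, Remark 2.12] + [DaoTakahashi2014, Lemma 5.6] + `pd_R(R/(a)) ≤ 1`;
see the module docstring.) [OURS · folklore mechanism] -/
theorem mem_cohomologyAnnihilatorOfDegree_of_mk_mem [IsNoetherianRing R] {a : R} (ha : a ∈ R⁰) {m : ℕ}
    (haca : a ∈ cohomologyAnnihilatorOfDegree R (m + 2)) {c : R}
    (hc : Ideal.Quotient.mk (Ideal.span {a}) c ∈ cohomologyAnnihilatorOfDegree (R ⧸ Ideal.span {a}) (m + 1)) :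
    c ∈ cohomologyAnnihilatorOfDegree R (m + 2) := by
  rw [mem_cohomologyAnnihilatorOfDegree_succ_iff_forall_isSyzygy]
  intro X N hX hN
  haveI := hX
  haveI : Module.Finite R N := finite_of_isSyzygy (m + 1) hX hN
  -- peel: `N = Ωᵐ X₁`, `X₁ = Ω X`, `a` regular on `X₁` and on `N`
  obtain ⟨X₁, hX₁, hN₁⟩ := isSyzygy_succ_iff_exists_first.mp hN
  haveI : Module.Finite R X₁ := finite_of_isSyzygy 1 hX hX₁
  have hregX₁ : IsSMulRegular X₁ a := isSMulRegular_of_isSyzygy_succ ha hX₁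
  have hregN : IsSMulRegular N a := isSMulRegular_of_isSyzygy_succ ha hN
  -- Dao–Takahashi: `N/aN = Ωᵐ_{R/(a)} (X₁/aX₁)`
  obtain ⟨hNq, -⟩ := IsSyzygy.quotSMulTop ha hN₁ hregX₁
  haveI : Module.Finite (R ⧸ Ideal.span {a})
      (ModuleCat.of (R ⧸ Ideal.span {a}) (X₁ ⧸ (a • ⊤ : Submodule R X₁))) :=
    Module.Finite.of_restrictScalars_finite R _ _
  -- `c̄` stably annihilates `N/aN` over `R/(a)`
  have hstab : StablyAnnihilates (R ⧸ Ideal.span {a}) (Ideal.Quotient.mk (Ideal.span {a}) c)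
      (ModuleCat.of (R ⧸ Ideal.span {a}) (N ⧸ (a • ⊤ : Submodule R N))) :=
    (mem_cohomologyAnnihilatorOfDegree_succ_iff_forall_isSyzygy _).mp hc _ _ inferInstance hNq
  -- `a` kills `Ext¹_R(N, -)`: `N` is an `(m+1)`-th syzygy and `a ∈ caᵐ⁺²(R)`
  have haN : ∀ Y : ModuleCat.{u} R, Module.Finite R Y → ∀ e : Ext.{u} N Y 1, a • e = 0 := by
    intro Y hY e
    haveI := hY
    exact ext_smul_eq_zero_of_isSyzygy (m + 1) hN Y 1 le_rfl a
      (fun e' => smul_eq_zero_of_mem_cohomologyAnnihilatorOfDegree haca (i := 1 + (m + 1)) (by omega) e') e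
  -- Knörrer / IT Remark 2.12: `N` is a retract of a first syzygy `L` of `N/aN`
  obtain ⟨L, hL, i, p, hip⟩ := exists_retract_isSyzygy_quotSMulTop hregN haN
  -- conclude: `c` kills `Ext¹(N, -)`
  refine stablyAnnihilates_of_forall_smul_ext_one_eq_zero N fun Y hY e => ?_
  haveI := hY
  refine ext_smul_eq_zero_of_retract i p hip c (fun eL => ?_) e
  refine ext_smul_eq_zero_of_isSyzygy 1 hL Y 1 le_rfl c (fun e' => ?_) eL
  exact smul_ext_quot_eq_zero_of_stablyAnnihilates ha hstab Y (by omega) e'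

/-- Ideal form: `(caᵐ⁺¹(R ⧸ (a))).comap mk ≤ caᵐ⁺²(R)` for a non-zero-divisor `a ∈ caᵐ⁺²(R)`. [OURS] -/
theorem comap_cohomologyAnnihilatorOfDegree_quotient_le [IsNoetherianRing R] {a : R} (ha : a ∈ R⁰) {m : ℕ}
    (haca : a ∈ cohomologyAnnihilatorOfDegree R (m + 2)) :
    (cohomologyAnnihilatorOfDegree (R ⧸ Ideal.span {a}) (m + 1)).comap (Ideal.Quotient.mk (Ideal.span {a})) ≤
      cohomologyAnnihilatorOfDegree R (m + 2) :=
  fun _ hc => mem_cohomologyAnnihilatorOfDegree_of_mk_mem ha haca hc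

/-- Level-free form: if `a ∈ R⁰ ∩ caⁿ(R)` and `c̄ ∈ caⁿ'(R ⧸ (a))` then `c ∈ caᴺ(R)` for every `N` with
`n ≤ N`, `n' + 1 ≤ N` and `2 ≤ N`. [OURS] -/
theorem mem_cohomologyAnnihilatorOfDegree_of_mk_mem_of_le [IsNoetherianRing R] {a : R} (ha : a ∈ R⁰) {n n' N : ℕ}
    (haca : a ∈ cohomologyAnnihilatorOfDegree R n) {c : R}
    (hc : Ideal.Quotient.mk (Ideal.span {a}) c ∈ cohomologyAnnihilatorOfDegree (R ⧸ Ideal.span {a}) n')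
    (hnN : n ≤ N) (hn'N : n' + 1 ≤ N) (h2N : 2 ≤ N) :
    c ∈ cohomologyAnnihilatorOfDegree R N := by
  obtain ⟨m, rfl⟩ : ∃ m, N = m + 2 := ⟨N - 2, by omega⟩
  exact mem_cohomologyAnnihilatorOfDegree_of_mk_mem ha (cohomologyAnnihilatorOfDegree_mono hnN haca)
    (cohomologyAnnihilatorOfDegree_mono (show n' ≤ m + 1 by omega) hc)

/-- `ca`-form: for a non-zero-divisor `a ∈ ca(R)`, `(ca(R ⧸ (a))).comap mk ≤ ca(R)` — the cohomology annihilator of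
`R/(a)` lifts to `R` as soon as `a` itself is a cohomology annihilator (e.g. a Jacobian element of a hypersurface).
[OURS · the lower-bound half of Esentepe2020 Thm 5.4 / Knörrer periodicity, abstract form] -/
theorem comap_cohomologyAnnihilator_quotient_le [IsNoetherianRing R] {a : R} (ha : a ∈ R⁰)
    (haca : a ∈ cohomologyAnnihilator R) :
    (cohomologyAnnihilator (R ⧸ Ideal.span {a})).comap (Ideal.Quotient.mk (Ideal.span {a})) ≤
      cohomologyAnnihilator R := by
  intro c hc
  rw [Ideal.mem_comap, mem_cohomologyAnnihilator_iff] at hc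
  obtain ⟨n', hn'⟩ := hc
  obtain ⟨n, hn⟩ := mem_cohomologyAnnihilator_iff.mp haca
  exact mem_cohomologyAnnihilator_iff.mpr ⟨n + n' + 2,
    mem_cohomologyAnnihilatorOfDegree_of_mk_mem_of_le ha hn hn' (by omega) (by omega) (by omega)⟩

/-- The ascent theorem with the quotient ideal as a variable: `I = (a)`. (Useful when the quotient ring is presented as
`R ⧸ I` with `I` only propositionally equal to `(a)`, e.g. `I = (a').map f`.) [OURS] -/
theorem mem_cohomologyAnnihilatorOfDegree_of_mk_mem' [IsNoetherianRing R] {I : Ideal R} {a : R}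
    (hI : I = Ideal.span {a}) (ha : a ∈ R⁰) {m : ℕ} (haca : a ∈ cohomologyAnnihilatorOfDegree R (m + 2)) {c : R}
    (hc : Ideal.Quotient.mk I c ∈ cohomologyAnnihilatorOfDegree (R ⧸ I) (m + 1)) :
    c ∈ cohomologyAnnihilatorOfDegree R (m + 2) := by
  subst hI
  exact mem_cohomologyAnnihilatorOfDegree_of_mk_mem ha haca hc

end Summit.ResolutionOfSingularities.ResolutionOfSingularities.Theorems.HomologicalConductor.QuotientAscent

end
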